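import Literature.Computability.Complexity.UnaryOffsets
import Literature.Computability.Complexity.PlumbingBricks
import Literature.Computability.Complexity.BinarySearchPP
import Literature.Computability.Complexity.StringEquality
import Literature.Computability.Complexity.PSpaceClosure
import Literature.Computability.Complexity.GenericOracles
import Literature.Computability.Complexity.BPPSubsetAlmostP
import Literature.Computability.Complexity.CountingHierarchyInter
import HarnessLib

/-!
# Fixed-width segment tables: the oracle tables of the Standard Algorithm and their layered lookup in `PSPACE` (Fenner–Fortnow–Kurtz–Li, Lemma 6.17)

Support file for the named fact
`Literature.Barriers.QuantumAdvantage.fennerFortnowKurtzLi2003_thm618_awpp` (Fenner–Fortnow–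
Kurtz–Li, *An oracle builder's toolkit*, Inform. and Comput. 182 (2003), Thm. 6.18 (2)
rerelativized; `FFKLGenericCollapse.lean`, `FFKLTablePredicate.lean`, `FFKLWindow.lean`).

In the proof of Lemma 6.17 (p. 33) the `FPSPACE` function `F_j(x, α)` of the Standard Algorithm
works on FINITE PARTIAL ORACLES: the knowledge `α` acquired so far, a candidate certificate `β`,
and a completion `γ` ("`β` is a 1-certificate iff, for all `γ` compatible with `α ∪ β` and with size
at most `q(n)`, `M^{α∪β∪γ}(x)` accepts, where all queries outside `dom(α ∪ β ∪ γ)` are answered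
negatively"). This file fixes the string format in which the polynomial-time oracle machine of
Lemma 6.16 and the `PSPACE` side exchange such partial oracles, and proves that the layered lookup
"first `α`, then `β`, then `γ`, with the finite condition `σ` hard-wired and everything else
negative" is a `PSPACE` predicate of (table code, query):

* a partial oracle is a bit string cut into SEGMENTS of a fixed width `W(n)` (`FFKL.segOf`); a
  segment `s` names the string `FFKL.segStr s = fstP (tail (reverse s))` (the self-delimiting
  first component of its reversed body — the format in which the machine spells its probes, so that
  the probe is read off the reversed history by `fstP`) and carries the value bit
  `FFKL.segVal s` (its last bit); `FFKL.InS W s w` ("some segment of `s` names `w`") and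
  `FFKL.ValS W s w` ("some segment of `s` names `w` with value `1`");
* the same predicates as languages of records `⟨⟨s, x⟩, w⟩` (width `W(|x|)`), assembled from the
  tree's `FP` bricks (`UnaryOffsets.windowFn`, `UnaryOffsets.mulLenFn`, `Plumb.polyFn`,
  `BinSearchPP.reverse_mem_FP`, `setOf_apply_eq_apply_mem_P`) and a bounded existential
  quantifier over the unary segment index (`polyExists_mem_PSPACE`): `FFKL.Seg.InL`,
  `FFKL.Seg.ValL ∈ PSPACE` with their semantics `FFKL.Seg.mem_InL_iff`, `FFKL.Seg.mem_ValL_iff`;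
* **the layered table** `FFKL.layerTBL σ Wp`: on `⟨⟨x, ⟨h, ⟨c, γ⟩⟩⟩, w⟩` — `σ(w)` if
  `w ∈ dom σ`; else the value of `w` in `h` if `h` names `w`; else in `c`; else in `γ`; else `0`
  (values within one layer are OR-ed) — is in `PSPACE` (`FFKL.layerTBL_mem_PSPACE`, Boolean
  combinations through a Karp-`PSPACE`-complete set, `PSpaceClosure.lean`), with the membership
  lemma `FFKL.mem_layerTBL_iff` and `FFKL.extendedBy_layerTBL` (every table oracle extends `σ`,
  so a description categorical over `σ` keeps its promise on it — the hard-wiring of `σ` of §6.5,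
  p. 32).

## References

* [FennerFortnowKurtzLi2003IC] Lemma 6.17 (p. 33), §6.5 (p. 32), Fig. 1 (p. 29), read via
  `lit read doi:10.1016/s0890-5401(03)00018-x --pages 25-34`.
* [AroraBarakCC2009] §1.3 (robustness of polynomial time: addressing, copying), §4.2.
-/

noncomputable section

namespace Literature.Barriers.QuantumAdvantage

open _root_.Computability Literature.Computability.Complexity Literature.Computability.Complexity.Classes
  Literature.Computability.Complexity.CohenCondition Polynomial PRelSigma OracleCompose UnaryOffsets

namespace FFKL

/-! ### Segments of a bit string -/

/-- The `j`-th segment of width `W` of the string `s` (read with default `0` beyond the end of `s`).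
[cite: FennerFortnowKurtzLi2003IC, Lemma 6.17 (p. 33, finite partial oracles)] -/
def segOf (W : ℕ) (s : List Bool) (j : ℕ) : List Bool :=
  UnaryOffsets.window s (j * W) W

/-- The string named by a segment: the first component of its reversed body (the segment is
`code · value`, the code spells the reversal of `⟨z, pad⟩`). [cite: FennerFortnowKurtzLi2003IC, Fig. 1 (p. 29, "⟨β₀, β₁⟩ := f^σ(x, α)")] -/
def segStr (seg : List Bool) : List Bool :=
  fstP seg.reverse.tail

/-- The value bit of a segment: its last bit. [cite: FennerFortnowKurtzLi2003IC, Lemma 6.17 (p. 33)] -/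
def segVal (seg : List Bool) : Prop :=
  seg.reverse.head? = some true

/-- **`s` names `w`**: some segment of `s` names the string `w`. [cite: FennerFortnowKurtzLi2003IC, Lemma 6.17 (p. 33, dom(α))] -/
def InS (W : ℕ) (s w : List Bool) : Prop :=
  ∃ j, segStr (segOf W s j) = w

/-- **`s` sets `w`**: some segment of `s` names `w` with value `1`. [cite: FennerFortnowKurtzLi2003IC, Lemma 6.17 (p. 33, α(w) = 1)] -/
def ValS (W : ℕ) (s w : List Bool) : Prop :=
  ∃ j, segStr (segOf W s j) = w ∧ segVal (segOf W s j)

/-- Segments beyond the end of the string are all-zero. [folklore] -/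
theorem segOf_eq_replicate_of_le {W : ℕ} {s : List Bool} {j : ℕ} (h : s.length ≤ j * W) :
    segOf W s j = List.replicate W false := by
  unfold segOf UnaryOffsets.window
  rw [List.drop_eq_nil_of_le h, List.nil_append, List.take_replicate, min_self]

/-- Hence every segment index may be replaced by one below any bound exceeding `|s|`. [folklore] -/
theorem exists_segOf_iff_exists_le {W : ℕ} {s : List Bool} {b : ℕ} (hb : s.length ≤ b) (P : List Bool → Prop) :
    (∃ j, P (segOf W s j)) ↔ ∃ j ≤ b, P (segOf W s j) := by
  constructor
  · rintro ⟨j, hj⟩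
    by_cases hjb : j ≤ b
    · exact ⟨j, hjb, hj⟩
    · rcases Nat.eq_zero_or_pos W with hW | hW
      · refine ⟨0, Nat.zero_le _, ?_⟩
        have h0 : ∀ i, segOf W s i = [] := fun i => by
          simp [segOf, UnaryOffsets.window, hW]
        rwa [h0 j, ← h0 0] at hj
      · refine ⟨b, le_rfl, ?_⟩
        have hjW : s.length ≤ j * W := by nlinarith
        have hbW : s.length ≤ b * W := by nlinarith
        rwa [segOf_eq_replicate_of_le hjW, ← segOf_eq_replicate_of_le hbW] at hj
  · rintro ⟨j, -, hj⟩
    exact ⟨j, hj⟩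

/-! ### Segments of a concatenation of blocks; codes -/

/-- The segments of a concatenation of width-`W` blocks are the blocks. [folklore] -/
theorem segOf_flatten_of_lt {W : ℕ} {bs : List (List Bool)} (hlen : ∀ b ∈ bs, b.length = W) {j : ℕ}
    (hj : j < bs.length) : segOf W bs.flatten j = bs[j] := by
  induction bs generalizing j with
  | nil => simp at hj
  | cons b bs ih =>
    have hb : b.length = W := hlen b (by simp)
    have hlen' : ∀ b' ∈ bs, b'.length = W := fun b' hb' => hlen b' (by simp [hb'])
    cases j with
    | zero =>
      unfold segOf UnaryOffsets.window
      rw [Nat.zero_mul, List.drop_zero, List.flatten_cons, List.append_assoc,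
        List.take_append_of_le_length (by omega), List.take_of_length_le (by omega)]
      rfl
    | succ j =>
      have hj' : j < bs.length := by simpa using hj
      have h := ih hlen' hj'
      unfold segOf UnaryOffsets.window at h ⊢
      rw [List.flatten_cons, Nat.succ_mul, Nat.add_comm, ← List.drop_drop, List.drop_append_of_le_length (by omega),
        List.drop_of_length_le (le_of_eq hb), List.nil_append, h]
      simp

/-- The total length of width-`W` blocks. [folklore] -/
theorem length_flatten_of_blocks {W : ℕ} {bs : List (List Bool)} (hlen : ∀ b ∈ bs, b.length = W) :
    bs.flatten.length = bs.length * W := by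
  induction bs with
  | nil => simp
  | cons b bs ih =>
    rw [List.flatten_cons, List.length_append, ih fun b' hb' => hlen b' (by simp [hb']), hlen b (by simp),
      List.length_cons, Nat.succ_mul, Nat.add_comm]

/-- Beyond the blocks the segments are zero. [folklore] -/
theorem segOf_flatten_of_le {W : ℕ} {bs : List (List Bool)} (hlen : ∀ b ∈ bs, b.length = W) {j : ℕ}
    (hj : bs.length ≤ j) : segOf W bs.flatten j = List.replicate W false := by
  apply segOf_eq_replicate_of_le
  rw [length_flatten_of_blocks hlen]
  exact Nat.mul_le_mul_right _ hj

/-- The string named by an all-zero segment has length `⌊(W - 1)/2⌋` (so it is never a short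
string when `W` is large). [folklore] -/
theorem length_segStr_replicate (W : ℕ) : (segStr (List.replicate W false)).length = (W - 1) / 2 := by
  unfold segStr
  rw [List.reverse_replicate]
  cases W with
  | zero => rfl
  | succ T =>
    rw [List.replicate_succ, List.tail_cons, Nat.add_sub_cancel]
    suffices h : ∀ T, (fstP (List.replicate T false)).length = T / 2 from h T
    intro T
    induction T using Nat.strongRecOn with
    | _ T ih =>
      match T with
      | 0 => rfl
      | 1 => rfl
      | T + 2 =>
        have h := ih T (by omega)
        simp only [fstP, List.replicate_succ, boolUnpair, ite_true, List.length_cons] at h ⊢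
        omega

/-- An all-zero segment has value `0`. [folklore] -/
theorem not_segVal_replicate (W : ℕ) : ¬ segVal (List.replicate W false) := by
  unfold segVal
  rw [List.reverse_replicate]
  cases W <;> simp [List.replicate_succ]

/-- **The code of a probe**: zero padding followed by the REVERSAL of `⟨z, ε⟩`, of width `T`
(when `2|z| + 2 ≤ T`); read backwards — from the end of a history, or of a segment without its
value bit — it spells `⟨z, 0…⟩`, whose first component is `z`. [cite: FennerFortnowKurtzLi2003IC, Fig. 1 (p. 29) and Lemma 6.16] -/
def mkCode (T : ℕ) (z : List Bool) : List Bool :=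
  List.replicate (T - (2 * z.length + 2)) false ++ (boolPair z []).reverse

/-- The code has width `T`. [folklore] -/
theorem length_mkCode {T : ℕ} {z : List Bool} (h : 2 * z.length + 2 ≤ T) : (mkCode T z).length = T := by
  simp only [mkCode, List.length_append, List.length_replicate, List.length_reverse, length_boolPair,
    List.length_nil]
  omega

/-- The reversed code is `⟨z, 0…⟩`. [folklore] -/
theorem reverse_mkCode (T : ℕ) (z : List Bool) :
    (mkCode T z).reverse = boolPair z (List.replicate (T - (2 * z.length + 2)) false) := by
  rw [mkCode, List.reverse_append, List.reverse_reverse, List.reverse_replicate]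
  simp [boolPair]

/-- **The machine reads the probe off the reversed history**: `fstP ((h · code z)ʳ) = z`.
[cite: FennerFortnowKurtzLi2003IC, Fig. 1 (p. 29, "⟨β₀, β₁⟩ := f^σ(x, α)")] -/
theorem fstP_reverse_append_mkCode (h : List Bool) (T : ℕ) (z : List Bool) :
    fstP ((h ++ mkCode T z).reverse) = z := by
  rw [List.reverse_append, reverse_mkCode]
  have h' : ∀ a t : List Bool, boolPair z a ++ t = boolPair z (a ++ t) := fun a t => by simp [boolPair]
  rw [h', fstP_boolPair]

/-- **The table reads the probe off a segment**: the segment `code z · a` names `z`. [cite: FennerFortnowKurtzLi2003IC, Lemma 6.17 (p. 33)] -/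
theorem segStr_mkCode_append (T : ℕ) (z : List Bool) (a : Bool) : segStr (mkCode T z ++ [a]) = z := by
  unfold segStr
  rw [List.reverse_append, List.reverse_singleton, List.singleton_append, List.tail_cons, reverse_mkCode, fstP_boolPair]

/-- The segment `code z · a` has value `a`. [cite: FennerFortnowKurtzLi2003IC, Lemma 6.17 (p. 33)] -/
theorem segVal_mkCode_append (T : ℕ) (z : List Bool) (a : Bool) : segVal (mkCode T z ++ [a]) ↔ a = true := by
  unfold segVal
  rw [List.reverse_append, List.reverse_singleton, List.singleton_append, List.head?_cons, Option.some.injEq]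

/-- The segment `code z · a` has width `T + 1`. [folklore] -/
theorem length_mkCode_append {T : ℕ} {z : List Bool} (h : 2 * z.length + 2 ≤ T) (a : Bool) :
    (mkCode T z ++ [a]).length = T + 1 := by
  rw [List.length_append, length_mkCode h, List.length_singleton]

namespace Seg

/-! ### The segment predicates as languages of records `⟨⟨⟨s, x⟩, w⟩, j⟩` -/

variable (Wp : Polynomial ℕ)

/-- **The addressed segment** of a record `⟨⟨⟨s, x⟩, w⟩, j⟩`: segment `|j|` of width `W(|x|)`
of `s` (`windowFn` at the unary offset `|j|·W(|x|)` from `mulLenFn`; the projections are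
`s = fstP (fstP (fstP u))`, `x = sndP (fstP (fstP u))`, `w = sndP (fstP u)`, `j = sndP u`).
[cite: AroraBarakCC2009, §1.3] -/
def segMap : List Bool → List Bool :=
  windowFn Wp ∘ pairFn (pairFn (fstP ∘ fstP ∘ fstP)
    (mulLenFn ∘ pairFn sndP (Plumb.polyFn Wp ∘ sndP ∘ fstP ∘ fstP))) (sndP ∘ fstP ∘ fstP)

/-- The string named by the addressed segment. [cite: AroraBarakCC2009, §1.3] -/
def strMap : List Bool → List Bool :=
  fstP ∘ List.tail ∘ List.reverse ∘ segMap Wp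

/-- `segMap ∈ FP`. [cite: AroraBarakCC2009, §1.3] -/
theorem segMap_mem_FP : segMap Wp ∈ FP :=
  comp_mem_FP (windowFn_mem_FP Wp) (pairFn_mem_FP
    (pairFn_mem_FP (comp_mem_FP fstP_mem_FP (comp_mem_FP fstP_mem_FP fstP_mem_FP))
      (comp_mem_FP mulLenFn_mem_FP (pairFn_mem_FP sndP_mem_FP
        (comp_mem_FP (Plumb.polyFn_mem_FP Wp) (comp_mem_FP sndP_mem_FP (comp_mem_FP fstP_mem_FP fstP_mem_FP))))))
    (comp_mem_FP sndP_mem_FP (comp_mem_FP fstP_mem_FP fstP_mem_FP)))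

/-- `strMap ∈ FP`. [cite: AroraBarakCC2009, §1.3] -/
theorem strMap_mem_FP : strMap Wp ∈ FP :=
  comp_mem_FP fstP_mem_FP (comp_mem_FP tail_mem_FP (comp_mem_FP BinSearchPP.reverse_mem_FP (segMap_mem_FP Wp)))

/-- Semantics of `segMap` on a record. [folklore] -/
theorem segMap_apply (s x w j : List Bool) :
    segMap Wp (boolPair (boolPair (boolPair s x) w) j) = segOf (Wp.eval x.length) s j.length := by
  simp [segMap, windowFn_apply, segOf, length_mulLenFn]

/-- Semantics of `strMap` on a record. [folklore] -/
theorem strMap_apply (s x w j : List Bool) :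
    strMap Wp (boolPair (boolPair (boolPair s x) w) j) = segStr (segOf (Wp.eval x.length) s j.length) := by
  simp [strMap, segMap_apply, segStr]

/-- **"The addressed segment names `w`"**, a `P` language. [cite: AroraBarakCC2009, §1.3] -/
def ProbeAt : Language Bool := {u | strMap Wp u = sndP (fstP u)}

/-- **"The addressed segment names `w` with value `1`"**, a `P` language. [cite: AroraBarakCC2009, §1.3] -/
def TrueAt : Language Bool := ProbeAt Wp ⊓ ((List.reverse ∘ segMap Wp) ⁻¹' HeadIs true)

/-- `ProbeAt ∈ P`. [cite: AroraBarakCC2009, §1.3] -/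
theorem ProbeAt_mem_P : ProbeAt Wp ∈ Classes.P :=
  setOf_apply_eq_apply_mem_P (strMap_mem_FP Wp) (comp_mem_FP sndP_mem_FP fstP_mem_FP)

/-- `TrueAt ∈ P`. [cite: AroraBarakCC2009, §1.3] -/
theorem TrueAt_mem_P : TrueAt Wp ∈ Classes.P :=
  inter_mem_P (ProbeAt_mem_P Wp) (preimage_mem_P (HeadIs_mem_P true)
    (comp_mem_FP BinSearchPP.reverse_mem_FP (segMap_mem_FP Wp)))

/-- Semantics of `ProbeAt`. [folklore] -/
theorem mem_ProbeAt_iff (s x w j : List Bool) :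
    boolPair (boolPair (boolPair s x) w) j ∈ ProbeAt Wp ↔ segStr (segOf (Wp.eval x.length) s j.length) = w := by
  show strMap Wp _ = sndP (fstP _) ↔ _
  rw [strMap_apply, fstP_boolPair, sndP_boolPair]

/-- Semantics of `TrueAt`. [folklore] -/
theorem mem_TrueAt_iff (s x w j : List Bool) :
    boolPair (boolPair (boolPair s x) w) j ∈ TrueAt Wp ↔
      segStr (segOf (Wp.eval x.length) s j.length) = w ∧ segVal (segOf (Wp.eval x.length) s j.length) := by
  rw [TrueAt, Language.mem_inf, mem_ProbeAt_iff]
  apply and_congr_right fun _ => ?_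
  show (List.reverse ∘ segMap Wp) _ ∈ HeadIs true ↔ _
  rw [Function.comp_apply, segMap_apply, mem_HeadIs, segVal]

/-- **"Some segment of `s` names `w`"** as a language of records `⟨⟨s, x⟩, w⟩`: a bounded
existential quantifier over the unary segment index. [cite: AroraBarakCC2009, §4.2 (NP ⊆ PSPACE)] -/
def InL : Language Bool :=
  {v | ∃ j : List Bool, j.length ≤ (X : Polynomial ℕ).eval v.length ∧ boolPair v j ∈ ProbeAt Wp}

/-- **"Some segment of `s` sets `w`"** as a language of records. [cite: AroraBarakCC2009, §4.2] -/
def ValL : Language Bool :=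
  {v | ∃ j : List Bool, j.length ≤ (X : Polynomial ℕ).eval v.length ∧ boolPair v j ∈ TrueAt Wp}

/-- `InL ∈ PSPACE`. [cite: AroraBarakCC2009, Thm. 4.2 and §4.1] -/
theorem InL_mem_PSPACE : InL Wp ∈ PSPACE :=
  polyExists_mem_PSPACE (P_subset_PSPACE_holds (ProbeAt_mem_P Wp)) X

/-- `ValL ∈ PSPACE`. [cite: AroraBarakCC2009, Thm. 4.2 and §4.1] -/
theorem ValL_mem_PSPACE : ValL Wp ∈ PSPACE :=
  polyExists_mem_PSPACE (P_subset_PSPACE_holds (TrueAt_mem_P Wp)) X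

/-- A record is longer than its string component. [folklore] -/
theorem length_le_length_record (s x w : List Bool) : s.length ≤ (boolPair (boolPair s x) w).length := by
  simp only [length_boolPair]; omega

/-- **Semantics of `InL`.** [folklore] -/
theorem mem_InL_iff (s x w : List Bool) :
    boolPair (boolPair s x) w ∈ InL Wp ↔ InS (Wp.eval x.length) s w := by
  unfold InS
  rw [exists_segOf_iff_exists_le (length_le_length_record s x w) fun seg => segStr seg = w]
  show (∃ j : List Bool, j.length ≤ (X : Polynomial ℕ).eval (boolPair (boolPair s x) w).length ∧
      boolPair (boolPair (boolPair s x) w) j ∈ ProbeAt Wp) ↔ _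
  simp only [eval_X, mem_ProbeAt_iff]
  constructor
  · rintro ⟨j, hj, h⟩
    exact ⟨j.length, hj, h⟩
  · rintro ⟨j, hj, h⟩
    exact ⟨List.replicate j true, by simpa using hj, by simpa using h⟩

/-- **Semantics of `ValL`.** [folklore] -/
theorem mem_ValL_iff (s x w : List Bool) :
    boolPair (boolPair s x) w ∈ ValL Wp ↔ ValS (Wp.eval x.length) s w := by
  unfold ValS
  rw [exists_segOf_iff_exists_le (length_le_length_record s x w) fun seg => segStr seg = w ∧ segVal seg]
  show (∃ j : List Bool, j.length ≤ (X : Polynomial ℕ).eval (boolPair (boolPair s x) w).length ∧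
      boolPair (boolPair (boolPair s x) w) j ∈ TrueAt Wp) ↔ _
  simp only [eval_X, mem_TrueAt_iff]
  constructor
  · rintro ⟨j, hj, h⟩
    exact ⟨j.length, hj, h⟩
  · rintro ⟨j, hj, h⟩
    exact ⟨List.replicate j true, by simpa using hj, by simpa using h⟩

end Seg

/-! ### Finite languages -/

/-- Finite languages are in `P` (they are their own short part). [folklore] -/
theorem mem_P_of_finite {S : Language Bool} (hS : Set.Finite (S : Set (List Bool))) : S ∈ Classes.P := by
  have heq : S = ({x | x ∈ S ∧ x.length < hS.toFinset.sup List.length + 1} : Language Bool) := by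
    refine Set.ext fun x => ⟨fun h => ⟨h, ?_⟩, fun h => h.1⟩
    have : x.length ≤ hS.toFinset.sup List.length := Finset.le_sup (f := List.length) (hS.mem_toFinset.2 h)
    omega
  rw [heq]
  exact shortPart_mem_P S _

/-! ### The layered table -/

variable (σ : CohenCondition) (Wp : Polynomial ℕ)

/-- Record of the `h`-layer: `⟨⟨x, ⟨h, ⟨c, γ⟩⟩⟩, w⟩ ↦ ⟨⟨h, x⟩, w⟩`. [folklore] -/
def recH : List Bool → List Bool :=
  pairFn (pairFn (fstP ∘ sndP ∘ fstP) (fstP ∘ fstP)) sndP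

/-- Record of the `c`-layer: `⟨⟨x, ⟨h, ⟨c, γ⟩⟩⟩, w⟩ ↦ ⟨⟨c, x⟩, w⟩`. [folklore] -/
def recC : List Bool → List Bool :=
  pairFn (pairFn (fstP ∘ sndP ∘ sndP ∘ fstP) (fstP ∘ fstP)) sndP

/-- Record of the `γ`-layer: `⟨⟨x, ⟨h, ⟨c, γ⟩⟩⟩, w⟩ ↦ ⟨⟨γ, x⟩, w⟩`. [folklore] -/
def recG : List Bool → List Bool :=
  pairFn (pairFn (sndP ∘ sndP ∘ sndP ∘ fstP) (fstP ∘ fstP)) sndP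

/-- `recH ∈ FP`. [folklore] -/
theorem recH_mem_FP : recH ∈ FP :=
  pairFn_mem_FP (pairFn_mem_FP (comp_mem_FP fstP_mem_FP (comp_mem_FP sndP_mem_FP fstP_mem_FP))
    (comp_mem_FP fstP_mem_FP fstP_mem_FP)) sndP_mem_FP
/-- `recC ∈ FP`. [folklore] -/
theorem recC_mem_FP : recC ∈ FP :=
  pairFn_mem_FP (pairFn_mem_FP (comp_mem_FP fstP_mem_FP (comp_mem_FP sndP_mem_FP (comp_mem_FP sndP_mem_FP fstP_mem_FP)))
    (comp_mem_FP fstP_mem_FP fstP_mem_FP)) sndP_mem_FP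
/-- `recG ∈ FP`. [folklore] -/
theorem recG_mem_FP : recG ∈ FP :=
  pairFn_mem_FP (pairFn_mem_FP (comp_mem_FP sndP_mem_FP (comp_mem_FP sndP_mem_FP (comp_mem_FP sndP_mem_FP fstP_mem_FP)))
    (comp_mem_FP fstP_mem_FP fstP_mem_FP)) sndP_mem_FP

/-- Semantics of `recH`. [folklore] -/
theorem recH_apply (x h c g w : List Bool) :
    recH (boolPair (boolPair x (boolPair h (boolPair c g))) w) = boolPair (boolPair h x) w := by
  simp [recH]
/-- Semantics of `recC`. [folklore] -/
theorem recC_apply (x h c g w : List Bool) :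
    recC (boolPair (boolPair x (boolPair h (boolPair c g))) w) = boolPair (boolPair c x) w := by
  simp [recC]
/-- Semantics of `recG`. [folklore] -/
theorem recG_apply (x h c g w : List Bool) :
    recG (boolPair (boolPair x (boolPair h (boolPair c g))) w) = boolPair (boolPair g x) w := by
  simp [recG]

/-- The strings `σ` makes positive (finite). [cite: FennerFortnowKurtzLi2003IC, §6.5 (p. 32, hard-wiring the finite condition σ)] -/
def sigmaPos : Language Bool := {w | σ.val w = some true}

/-- The domain of `σ` as a language (finite). [cite: FennerFortnowKurtzLi2003IC, §6.5 (p. 32)] -/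
def sigmaDom : Language Bool := {w | w ∈ σ.dom}

/-- `sigmaPos σ ∈ P` (finite). [folklore] -/
theorem sigmaPos_mem_P : sigmaPos σ ∈ Classes.P :=
  mem_P_of_finite (σ.dom_finite.subset fun w (hw : σ.val w = some true) => by
    rw [CohenCondition.mem_dom_iff, hw]; exact Option.some_ne_none true)

/-- `sigmaDom σ ∈ P` (finite). [folklore] -/
theorem sigmaDom_mem_P : sigmaDom σ ∈ Classes.P :=
  mem_P_of_finite σ.dom_finite

/-- **The layered table** of the Standard Algorithm's certificate test: on `⟨⟨x, ⟨h, ⟨c, γ⟩⟩⟩, w⟩`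
(segment width `W(|x|)`) — `σ(w)` on `dom σ`; else the value of `w` in the knowledge `h` if `h`
names `w`; else in the candidate certificate `c` if `c` names `w`; else in the completion `γ`
("`M^{α∪β∪γ}(x)` …, where all queries outside `dom(α ∪ β ∪ γ)` are answered negatively").
[cite: FennerFortnowKurtzLi2003IC, Lemma 6.17 (p. 33) and §6.5 (p. 32)] -/
def layerTBL : Language Bool :=
  {u | sndP u ∈ sigmaPos σ ∨ (sndP u ∉ sigmaDom σ ∧
    (recH u ∈ Seg.ValL Wp ∨ (recH u ∉ Seg.InL Wp ∧
      (recC u ∈ Seg.ValL Wp ∨ (recC u ∉ Seg.InL Wp ∧ recG u ∈ Seg.ValL Wp)))))}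

variable {σ Wp}

/-- **The layered table is a `PSPACE` predicate** (given a Karp-`PSPACE`-complete set, for the
Boolean combinations). [cite: FennerFortnowKurtzLi2003IC, Lemma 6.17 and the remark after it (p. 33, "F_j ∈ FPSPACE")] -/
theorem layerTBL_mem_PSPACE {C : Language Bool} (hC : IsComplete PSPACE C) (σ : CohenCondition) (Wp : Polynomial ℕ) :
    layerTBL σ Wp ∈ PSPACE := by
  have hP : ∀ {L : Language Bool}, L ∈ Classes.P → L ∈ PSPACE := fun h => P_subset_PSPACE_holds h
  have hIn : ∀ {f : List Bool → List Bool}, f ∈ FP → ({u | f u ∈ Seg.InL Wp} : Language Bool) ∈ PSPACE :=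
    fun hf => preimage_mem_PSPACE (Seg.InL_mem_PSPACE Wp) hf
  have hVal : ∀ {f : List Bool → List Bool}, f ∈ FP → ({u | f u ∈ Seg.ValL Wp} : Language Bool) ∈ PSPACE :=
    fun hf => preimage_mem_PSPACE (Seg.ValL_mem_PSPACE Wp) hf
  have hnIn : ∀ {f : List Bool → List Bool}, f ∈ FP → ({u | f u ∉ Seg.InL Wp} : Language Bool) ∈ PSPACE :=
    fun hf => compl_mem_PSPACE (hIn hf)
  have hpos : ({u | sndP u ∈ sigmaPos σ} : Language Bool) ∈ PSPACE := hP (preimage_mem_P (sigmaPos_mem_P σ) sndP_mem_FP)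
  have hdom : ({u | sndP u ∉ sigmaDom σ} : Language Bool) ∈ PSPACE :=
    compl_mem_PSPACE (hP (preimage_mem_P (sigmaDom_mem_P σ) sndP_mem_FP))
  refine setOf_or_mem_PSPACE_of_complete hC hpos (setOf_and_mem_PSPACE_of_complete hC hdom ?_)
  refine setOf_or_mem_PSPACE_of_complete hC (hVal recH_mem_FP) (setOf_and_mem_PSPACE_of_complete hC (hnIn recH_mem_FP) ?_)
  refine setOf_or_mem_PSPACE_of_complete hC (hVal recC_mem_FP) ?_
  exact setOf_and_mem_PSPACE_of_complete hC (hnIn recC_mem_FP) (hVal recG_mem_FP)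

/-- **Semantics of the layered table.** [cite: FennerFortnowKurtzLi2003IC, Lemma 6.17 (p. 33)] -/
theorem mem_layerTBL_iff (σ : CohenCondition) (Wp : Polynomial ℕ) (x h c g w : List Bool) :
    boolPair (boolPair x (boolPair h (boolPair c g))) w ∈ layerTBL σ Wp ↔
      σ.val w = some true ∨ (w ∉ σ.dom ∧
        (ValS (Wp.eval x.length) h w ∨ (¬ InS (Wp.eval x.length) h w ∧
          (ValS (Wp.eval x.length) c w ∨ (¬ InS (Wp.eval x.length) c w ∧ ValS (Wp.eval x.length) g w))))) := by
  show (sndP _ ∈ sigmaPos σ ∨ (sndP _ ∉ sigmaDom σ ∧ (recH _ ∈ Seg.ValL Wp ∨ (recH _ ∉ Seg.InL Wp ∧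
    (recC _ ∈ Seg.ValL Wp ∨ (recC _ ∉ Seg.InL Wp ∧ recG _ ∈ Seg.ValL Wp)))))) ↔ _
  rw [sndP_boolPair, recH_apply, recC_apply, recG_apply, Seg.mem_InL_iff, Seg.mem_ValL_iff, Seg.mem_InL_iff,
    Seg.mem_ValL_iff, Seg.mem_ValL_iff]
  exact Iff.rfl

/-- On the domain of `σ` the table follows `σ`, whatever the table code. [cite: FennerFortnowKurtzLi2003IC, §6.5 (p. 32)] -/
theorem boolPair_mem_layerTBL_of_mem_dom (σ : CohenCondition) (Wp : Polynomial ℕ) (t : List Bool) {w : List Bool}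
    {b : Bool} (hb : σ.val w = some b) : boolPair t w ∈ layerTBL σ Wp ↔ b = true := by
  have hdom : w ∈ σ.dom := by rw [CohenCondition.mem_dom_iff, hb]; exact Option.some_ne_none b
  show (sndP _ ∈ sigmaPos σ ∨ (sndP _ ∉ sigmaDom σ ∧ _)) ↔ _
  rw [sndP_boolPair]
  constructor
  · rintro (h | ⟨h, -⟩)
    · have : some b = some true := hb.symm.trans h
      exact Option.some.inj this
    · exact absurd hdom h
  · rintro rfl
    exact Or.inl hb

/-- **Every table oracle extends `σ`.** [cite: FennerFortnowKurtzLi2003IC, §6.5 (p. 32, "we can restrict attention to machines … categorical over σ")] -/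
theorem extendedBy_layerTBL (σ : CohenCondition) (Wp : Polynomial ℕ) (t : List Bool) :
    σ.ExtendedBy {w | boolPair t w ∈ layerTBL σ Wp} := fun _ _ hb =>
  boolPair_mem_layerTBL_of_mem_dom σ Wp t hb


end FFKL

end Literature.Barriers.QuantumAdvantage

end
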